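import Mathlib.Analysis.SpecialFunctions.Integrability.Basic
import Literature.Analysis.FluidPDE.SerrinEnstrophyGronwallForced
import HarnessLib

/-!
# A maximal classical solution of FORCED Navier–Stokes leaves every Serrin class at its blow-up time
# (modulo the forced `H¹` continuation) — the `E–C` endpoint test "velocity ∉ LPS at `T*`", kernel form

HONEST FRAMING (cell `ns-blowup`, seat `ns-blowup-ecbridge-2` g0, human ruling D-0035): this cell
ATTEMPTS the negative direction of the Clay problem; nothing here is evidence about Navier–Stokes
regularity. WHAT THIS IS NOT: not a statement that any blow-up exists; it is the NECESSARY CONDITION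
any `E–C` CLAIM (forced breakdown, Clay (C)) must visibly pass — typed list ECBRIDGE-2-MEMO-1, row R2:
"the velocity leaves EVERY Serrin class `L^q_t L^r_x`, `2/q + 3/r = 1`, `3 < r ≤ ∞`, at `T*`".

The theorem `lintegral_serrin_eq_top_of_isMaximalSmoothSolution`: let `(u, p)` be a MAXIMAL smooth
solution of the forced system on `[0, T) × ℝ³` (`IsMaximalSmoothSolution ν f u p T`: classical on
`[0, T)`, no classical extension past `T`), lying in Tao's `L²`-Sobolev class on every closed sub-slab
`[0, T']`, `T' < T` (`u`, `∂ₜu` within `[0, T']`, `p`; and `f(t)`, `Df(t)` square integrable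
uniformly there), with a measurable majorant `F ≥ ‖f(t)‖²_{L²}` integrable on `(0, T)`. ASSUME the
forced `H¹` continuation property for this solution — bounded enstrophy on `[0, T)` would give a
classical extension past `T` (the content of the named fact
`Literature.Analysis.FluidPDE.lemarieRieusset2016_H1_continuation_forced`, Lemarié-Rieusset 2016,
Thm. 7.2; taken here as the explicit hypothesis `hext` so that this file does not depend on that
fact's file and the user discharges it with whatever continuation theorem is available). THEN for
every `3 < r ≤ ∞` the Serrin integral `∫₀ᵀ ‖u(t)‖_{L^r}^{2/(1-3/r)} dt` is INFINITE. Proof: if it were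
finite, the PROVED forced Serrin enstrophy inequality
`Literature.Analysis.FluidPDE.enstrophy_le_of_serrin_forced_uniform` (Lemarié-Rieusset 2016,
Thm. 11.2, (11.11) with `f ∈ L²_tL²_x`) bounds the enstrophy uniformly on `[0, T)`, `hext` extends the
solution, contradicting maximality. This is Lemarié-Rieusset's Thm. 11.2, second clause ("if
`T_MAX < +∞` then `∫₀^{T_MAX} ‖u‖_q^p dt = +∞`"), for maximal CLASSICAL solutions, the continuation
step isolated as a hypothesis.

Intended consumer: `Summit.NavierStokesRegularity.FluidComputer.PalasekTowerClayBridge.Realisation`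
(seat ecbridge-1): an instance is maximal (`Realisation.isMaximalSmoothSolution`), so — given the Tao
class of its slabs and the continuation fact — its velocity is outside every Serrin class at `T`.
-/

noncomputable section

namespace Summit.NavierStokesRegularity.FluidComputer.SerrinDivergenceMaximalForced

open Set MeasureTheory Function Literature.Analysis.FluidPDE
open scoped ENNReal NNReal

/-- **A maximal classical solution of the forced Navier–Stokes system is outside every Serrin class
at its blow-up time** (modulo the forced `H¹` continuation `hext`). See the module docstring. The
Serrin exponent is written as in `enstrophy_le_of_serrin_forced_uniform`: time exponent
`2/θ`, `θ = 1 - (3/r).toReal` (`= 2r/(r-3)`, `= 2` for `r = ∞`). -/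
theorem lintegral_serrin_eq_top_of_isMaximalSmoothSolution {ν T : ℝ} (hν : 0 < ν) (hT : 0 < T)
    {u f : ℝ → EuclideanSpace ℝ (Fin 3) → EuclideanSpace ℝ (Fin 3)}
    {p : ℝ → EuclideanSpace ℝ (Fin 3) → ℝ}
    (hmax : IsMaximalSmoothSolution ν f u p T)
    (hu : ∀ T' ∈ Ioo 0 T, HasBoundedSobolevNormsOn (Icc 0 T') u)
    (hut : ∀ T' ∈ Ioo 0 T,
      HasBoundedSobolevNormsOn (Icc 0 T') (timeDerivWithin (Icc 0 T') u))
    (hp : ∀ T' ∈ Ioo 0 T, ∀ n : ℕ, ∃ C : ℝ≥0, ∀ t ∈ Icc 0 T',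
      ∫⁻ x, ‖iteratedFDeriv ℝ n (p t) x‖ₑ ^ 2 ≤ C)
    (hf : ∀ T' ∈ Ioo 0 T, ∀ n : ℕ, n ≤ 1 → ∃ C : ℝ≥0, ∀ t ∈ Icc 0 T',
      ∫⁻ x, ‖iteratedFDeriv ℝ n (f t) x‖ₑ ^ 2 ≤ C)
    (F : ℝ → ℝ≥0∞) (hFm : Measurable F) (hF : ∀ t ∈ Ioo 0 T, ∫⁻ x, ‖f t x‖ₑ ^ 2 ≤ F t)
    (hFT : ∫⁻ t in Ioo 0 T, F t ≠ ⊤)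
    (hext : (∃ B : ℝ≥0, ∀ t ∈ Ico 0 T,
        ∫⁻ x, ENNReal.ofReal (frobeniusNormSq (fderiv ℝ (u t) x)) ≤ B) →
      HasSmoothExtensionPast ν f u T)
    {r : ℝ≥0∞} (hr : 3 < r) :
    ∫⁻ t in Ioo 0 T,
        ENNReal.ofReal ((eLpNorm (u t) r volume).toReal ^ (2 / (1 - (3 / r).toReal))) = ⊤ := by
  by_contra hA
  -- classical on every closed sub-slab `[0, T']`
  have hsol : ∀ T' ∈ Ioo 0 T, IsClassicalNSSolutionOn (Icc 0 T') ν f u p := fun T' hT' =>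
    hmax.1.mono (Icc_subset_Ico_right hT'.2) (uniqueDiffOn_Icc hT'.1)
  -- the proved forced Serrin bound, uniform on `[0, T)`
  have hbound := enstrophy_le_of_serrin_forced_uniform (T := T) hν hsol hu hut hp hf F hFm hF hr
    rfl hA hFT
  -- the right-hand side is finite
  set Bound : ℝ≥0∞ := ENNReal.ofReal (Real.exp (2 * ((1 - (3 / r).toReal) *
      (2 * (1 - (1 - (3 / r).toReal))) ^ ((1 - (1 - (3 / r).toReal)) / (1 - (3 / r).toReal)) *
      2 ^ (-(1 / (1 - (3 / r).toReal))) *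
      (SNormLESNormFDerivOfEqConst (EuclideanSpace ℝ (Fin 3))
        (volume : Measure (EuclideanSpace ℝ (Fin 3))) 2 : ℝ) ^
          (2 * (1 - (1 - (3 / r).toReal)) / (1 - (3 / r).toReal))) *
      (ν / 2) ^ (1 - 2 / (1 - (3 / r).toReal)) *
      (∫⁻ t in Ioo 0 T,
        ENNReal.ofReal ((eLpNorm (u t) r volume).toReal ^ (2 / (1 - (3 / r).toReal)))).toReal)) *
    ((∫⁻ x, ENNReal.ofReal (frobeniusNormSq (fderiv ℝ (u 0) x))) +
      (ENNReal.ofReal ν)⁻¹ * ∫⁻ t in Ioo 0 T, F t) with hBound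
  -- initial enstrophy is finite (Tao class on `[0, T/2]`)
  have hT2 : T / 2 ∈ Ioo 0 T := ⟨by linarith, by linarith⟩
  obtain ⟨C₁, hC₁⟩ := hu (T / 2) hT2 1
  have h0fin : ∫⁻ x, ENNReal.ofReal (frobeniusNormSq (fderiv ℝ (u 0) x)) < ⊤ := by
    calc ∫⁻ x, ENNReal.ofReal (frobeniusNormSq (fderiv ℝ (u 0) x))
        ≤ ∫⁻ x, 3 * ‖iteratedFDeriv ℝ 1 (u 0) x‖ₑ ^ 2 := lintegral_mono fun x => by
          rw [← ofReal_norm, norm_iteratedFDeriv_one, ofReal_norm]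
          exact ofReal_frobeniusNormSq_le_three_mul_enorm_sq _
      _ = 3 * ∫⁻ x, ‖iteratedFDeriv ℝ 1 (u 0) x‖ₑ ^ 2 := lintegral_const_mul' _ _ (by norm_num)
      _ ≤ 3 * C₁ := by gcongr; exact hC₁ 0 ⟨le_rfl, by linarith⟩
      _ < ⊤ := ENNReal.mul_lt_top (by norm_num) ENNReal.coe_lt_top
  have hBtop : Bound ≠ ⊤ := by
    rw [hBound]
    refine ENNReal.mul_ne_top ENNReal.ofReal_ne_top (ENNReal.add_ne_top.2 ⟨h0fin.ne, ?_⟩)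
    exact ENNReal.mul_ne_top (ENNReal.inv_ne_top.2 (by positivity)) hFT
  -- hence a uniform enstrophy bound on `[0, T)`, and a smooth extension past `T`: contradiction
  have hB : ∃ B : ℝ≥0, ∀ t ∈ Ico 0 T,
      ∫⁻ x, ENNReal.ofReal (frobeniusNormSq (fderiv ℝ (u t) x)) ≤ B := by
    refine ⟨Bound.toNNReal, fun t ht => ?_⟩
    rw [ENNReal.coe_toNNReal hBtop]
    exact hbound t ht
  exact hmax.2 (hext hB)

/-- **No sub-Type-I blow-up with a force** (Type-II compatibility, cell `ns-blowup` KILLSHEET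
K2/K4, forced classical form): under the hypotheses of
`lintegral_serrin_eq_top_of_isMaximalSmoothSolution` (maximal classical solution of the forced system,
Tao class on closed sub-slabs, force with integrable `L²` majorant, forced `H¹` continuation `hext`),
the velocity CANNOT obey a sub-Type-I bound `‖u(t)‖_{L^∞} ≤ C (T - t)^{-γ}` on `[0, T)` with
`γ < 1/2`: the endpoint `r = ∞` of the Serrin divergence is `∫₀ᵀ ‖u‖²_∞ dt = ∞`, while
`∫₀ᵀ (T-t)^{-2γ} dt < ∞`. (Type I, `γ = 1/2`, is exactly the non-integrable borderline.) -/
theorem not_subTypeI_of_isMaximalSmoothSolution {ν T : ℝ} (hν : 0 < ν) (hT : 0 < T)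
    {u f : ℝ → EuclideanSpace ℝ (Fin 3) → EuclideanSpace ℝ (Fin 3)}
    {p : ℝ → EuclideanSpace ℝ (Fin 3) → ℝ}
    (hmax : IsMaximalSmoothSolution ν f u p T)
    (hu : ∀ T' ∈ Ioo 0 T, HasBoundedSobolevNormsOn (Icc 0 T') u)
    (hut : ∀ T' ∈ Ioo 0 T,
      HasBoundedSobolevNormsOn (Icc 0 T') (timeDerivWithin (Icc 0 T') u))
    (hp : ∀ T' ∈ Ioo 0 T, ∀ n : ℕ, ∃ C : ℝ≥0, ∀ t ∈ Icc 0 T',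
      ∫⁻ x, ‖iteratedFDeriv ℝ n (p t) x‖ₑ ^ 2 ≤ C)
    (hf : ∀ T' ∈ Ioo 0 T, ∀ n : ℕ, n ≤ 1 → ∃ C : ℝ≥0, ∀ t ∈ Icc 0 T',
      ∫⁻ x, ‖iteratedFDeriv ℝ n (f t) x‖ₑ ^ 2 ≤ C)
    (F : ℝ → ℝ≥0∞) (hFm : Measurable F) (hF : ∀ t ∈ Ioo 0 T, ∫⁻ x, ‖f t x‖ₑ ^ 2 ≤ F t)
    (hFT : ∫⁻ t in Ioo 0 T, F t ≠ ⊤)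
    (hext : (∃ B : ℝ≥0, ∀ t ∈ Ico 0 T,
        ∫⁻ x, ENNReal.ofReal (frobeniusNormSq (fderiv ℝ (u t) x)) ≤ B) →
      HasSmoothExtensionPast ν f u T)
    {C γ : ℝ} (hC : 0 ≤ C) (hγ : γ < 1 / 2)
    (hrate : ∀ t ∈ Ioo 0 T, eLpNorm (u t) ⊤ volume ≤ ENNReal.ofReal (C * (T - t) ^ (-γ))) :
    False := by
  have htop := lintegral_serrin_eq_top_of_isMaximalSmoothSolution hν hT hmax hu hut hp hf F hFm hF
    hFT hext (r := ⊤) (by simp)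
  have hexp : (2 : ℝ) / (1 - ((3 : ℝ≥0∞) / ⊤).toReal) = 2 := by
    rw [ENNReal.div_top, ENNReal.toReal_zero, sub_zero, div_one]
  rw [hexp] at htop
  -- the comparison integrand `C² (T - t)^{-2γ}` is integrable on `(0, T)`
  have hint : IntervalIntegrable (fun t : ℝ => (T - t) ^ (-(2 * γ))) volume 0 T := by
    have h := (intervalIntegral.intervalIntegrable_rpow' (a := T) (b := 0) (r := -(2 * γ))
      (by linarith)).comp_sub_left T
    simpa using h
  have hIntOn : IntegrableOn (fun t : ℝ => C ^ 2 * (T - t) ^ (-(2 * γ))) (Ioo 0 T) volume := by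
    have h1 := ((intervalIntegrable_iff_integrableOn_Ioc_of_le hT.le).1 hint).mono_set
      Ioo_subset_Ioc_self
    exact h1.const_mul _
  have hfin : ∫⁻ t in Ioo 0 T, ENNReal.ofReal (C ^ 2 * (T - t) ^ (-(2 * γ))) < ⊤ :=
    lt_of_le_of_lt (lintegral_ofReal_le_lintegral_enorm _) hIntOn.2
  -- pointwise comparison on `(0, T)`
  have hle : ∫⁻ t in Ioo 0 T, ENNReal.ofReal ((eLpNorm (u t) ⊤ volume).toReal ^ (2 : ℝ)) ≤
      ∫⁻ t in Ioo 0 T, ENNReal.ofReal (C ^ 2 * (T - t) ^ (-(2 * γ))) := by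
    refine setLIntegral_mono' measurableSet_Ioo fun t ht => ENNReal.ofReal_le_ofReal ?_
    have hTt : 0 < T - t := by linarith [ht.2]
    have hM0 : 0 ≤ C * (T - t) ^ (-γ) := mul_nonneg hC (Real.rpow_nonneg hTt.le _)
    have hN : (eLpNorm (u t) ⊤ volume).toReal ≤ C * (T - t) ^ (-γ) :=
      ENNReal.toReal_le_of_le_ofReal hM0 (hrate t ht)
    rw [Real.rpow_two]
    calc (eLpNorm (u t) ⊤ volume).toReal ^ 2 ≤ (C * (T - t) ^ (-γ)) ^ 2 :=
          pow_le_pow_left₀ ENNReal.toReal_nonneg hN 2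
      _ = C ^ 2 * (T - t) ^ (-(2 * γ)) := by
          rw [mul_pow, show -(2 * γ) = (-γ) * 2 by ring, Real.rpow_mul hTt.le, Real.rpow_two]
  exact absurd (htop ▸ hle) (not_le.2 hfin)

end Summit.NavierStokesRegularity.FluidComputer.SerrinDivergenceMaximalForced

end
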